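import Mathlib
import HarnessLib
import Summits.HubbardSuperconductivity.HubbardSuperconductivity.Theorems.KLProgrammeKLRegimeEnginePairLadderRelativeFlow
import Summits.HubbardSuperconductivity.HubbardSuperconductivity.Theorems.KLProgrammeKLRegimeEnginePairLadderResolvedDuhamel

/-!
# Route `KLProgramme` — ENGINE child gen 8 (stmt-HubbardSuperconductivity-20437 `KLRegimeEngineV17F2`), skeleton v2 class #5 rev 3:
# the RESOLVED relative step door — `kltc_relative_flow_duhamel_resolved`
# (cell gate-hubbard-kl, seat hubbard-kl-k3c1-p1 g15, technique «composed-map remainder propagation»)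

WHY.  `kltc_relative_flow_duhamel` (p583555, the class-#5 STEP door under rows 24–54 of KLTC-INDEX) bounds the relative residue
`Ẽ = A₁ + A₁·diag a·A₂ − A₂` of two member Riccati flows `Ȧᵢ = −Aᵢ·diag ḃᵢ·Aᵢ + Sᵢ` through the tangent-conjugation Duhamel, so the member
defects `S₁, S₂` enter through SUPS: `(4/3)·B·β·(8/3)(ξ₁+ξ₂)` (Bethe–Salpeter defects of the dressers against the a priori `B = δe^{2mβ} + 2 sup|X_rel|`) and,
at the keyed level, `sup|X_rel| ≤ ξΔ + m(ξ₁+ξ₂)Σ|a|`.  With the flat `M4²` member particle–hole rows these sup entries have no slot in the ROOM of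
`transferBarRelIdx` — the located «(X).3-PH-CUBIC-SLOT» (pen (R171)).  THIS FILE replaces the door: by the resolved two-sided dressed Duhamel
`kltc_resolved_dressing_duhamel` (adjoint supersolution weights; previous file), for remaining-variation majorants `vᵢ` of the member rates
(`‖ḃᵢ(t,c)‖ ≤ −v̇ᵢ(t,c)`, `vᵢ(1,·) ≥ 0`, `m·Σ_c vᵢ(0,c) ≤ 1/3` — in the model `vᵢ(t,c) = |bᵢ(1,c) − bᵢ(t,c)|`, `vᵢ(0,·) ≤ klRungProfile`):

  `‖Ẽ(1)(x,y)‖ ≤ S(x,y) + Σ_c S(x,c)·v₂(0,c)·(3m/2) + Σ_{a′} (3m/2)·v₁(0,a′)·S(a′,y) + Σ_{a′}Σ_c (3m/2)v₁(0,a′)·S(a′,c)·v₂(0,c)(3m/2)`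
  for any `S(x,y) ≥ ‖Ẽ(0)(x,y)‖ + I(x,y)`, `I(x,y) ≥ ∫₀¹‖X_rel(t)(x,y)‖dt`, `X_rel = S₁·(1 + diag a·A₂) + A₁·diag a·S₂ − S₂`

— the SAME four-term output shape as the door of record, but: no rate `β`, no `mβ ≤ 1/3`, no cumulative weights `bᵢ`, no source sups `ξ ξ₁ ξ₂`, no start sup `δ`,
no Bethe–Salpeter defects, a SINGLE FT dressing (the old door dressed `I` twice).  The member defects now enter ONLY through the resolved slice integral
of `X_rel`, i.e. (`kltc_relSource_resolved_le`) through `‖(S₁−S₂)(x,y)‖ + m·Σ_c‖S₁(x,c)‖·‖a(c)‖ + m·Σ_c‖a(c)‖·‖S₂(c,y)‖` — the member classes CONVOLVED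
against the relative weight `a` (an angular-mass slot: windowed masses of `klTransferWeight` × transfer profile of the member particle–hole classes),
never as sups.  Real analysis + matrix algebra over landed doors; nothing about the model is asserted; nothing asserts (X).3, (c), K3 or superconductivity.
0 kit · 0 lit.
-/

noncomputable section

namespace Summit.HubbardSuperconductivity.HubbardSuperconductivity.Theorems.KLRegimeSplit

set_option linter.dupNamespace false -- summit = problem name (single-conjunct summit), D-0017

open Finset Matrix Set
open Summit.HubbardSuperconductivity.HubbardSuperconductivity.Theorems.KLProgrammeCooperResummation

/-! ## §1 The resolved bound of the relative source -/

section Source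

variable {ι : Type*} [Fintype ι] [DecidableEq ι]

/-- **Resolved bound of the relative source**: `|Aᵢ| ≤ m` ⇒
`‖(S₁·(1 + diag a·A₂) + A₁·diag a·S₂ − S₂)(x,y)‖ ≤ ‖(S₁ − S₂)(x,y)‖ + m·Σ_c ‖S₁(x,c)‖·‖a c‖ + m·Σ_c ‖a c‖·‖S₂(c,y)‖` —
the member defects appear only CONVOLVED against the relative weight. -/
theorem kltc_relSource_resolved_le (S₁ S₂ A₁ A₂ : Matrix ι ι ℂ) (a : ι → ℂ) {m : ℝ}
    (hA₁ : ∀ x y, ‖A₁ x y‖ ≤ m) (hA₂ : ∀ x y, ‖A₂ x y‖ ≤ m) (x y : ι) :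
    ‖(S₁ * (1 + diagonal a * A₂) + A₁ * diagonal a * S₂ - S₂) x y‖ ≤
      ‖(S₁ - S₂) x y‖ + m * ∑ c, ‖S₁ x c‖ * ‖a c‖ + m * ∑ c, ‖a c‖ * ‖S₂ c y‖ := by
  have hm : 0 ≤ m := (norm_nonneg _).trans (hA₁ x y)
  have e : (S₁ * (1 + diagonal a * A₂) + A₁ * diagonal a * S₂ - S₂) x y =
      (S₁ - S₂) x y + (S₁ * diagonal a * A₂) x y + (A₁ * diagonal a * S₂) x y := by
    have : S₁ * (1 + diagonal a * A₂) + A₁ * diagonal a * S₂ - S₂ = (S₁ - S₂) + S₁ * diagonal a * A₂ + A₁ * diagonal a * S₂ := by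
      noncomm_ring
    rw [this, Matrix.add_apply, Matrix.add_apply]
  rw [e]
  have h1 : ‖(S₁ * diagonal a * A₂) x y‖ ≤ m * ∑ c, ‖S₁ x c‖ * ‖a c‖ := by
    rw [klli_mul_diag_mul_apply, mul_sum]
    refine (norm_sum_le _ _).trans (sum_le_sum fun c _ => ?_)
    rw [norm_mul, norm_mul]
    calc ‖S₁ x c‖ * ‖a c‖ * ‖A₂ c y‖ ≤ ‖S₁ x c‖ * ‖a c‖ * m :=
          mul_le_mul_of_nonneg_left (hA₂ c y) (mul_nonneg (norm_nonneg _) (norm_nonneg _))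
      _ = m * (‖S₁ x c‖ * ‖a c‖) := by ring
  have h2 : ‖(A₁ * diagonal a * S₂) x y‖ ≤ m * ∑ c, ‖a c‖ * ‖S₂ c y‖ := by
    rw [klli_mul_diag_mul_apply, mul_sum]
    refine (norm_sum_le _ _).trans (sum_le_sum fun c _ => ?_)
    rw [norm_mul, norm_mul, mul_assoc]
    exact mul_le_mul_of_nonneg_right (hA₁ x c) (mul_nonneg (norm_nonneg _) (norm_nonneg _))
  calc ‖(S₁ - S₂) x y + (S₁ * diagonal a * A₂) x y + (A₁ * diagonal a * S₂) x y‖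
      ≤ ‖(S₁ - S₂) x y‖ + ‖(S₁ * diagonal a * A₂) x y‖ + ‖(A₁ * diagonal a * S₂) x y‖ := norm_add₃_le
    _ ≤ _ := add_le_add (add_le_add le_rfl h1) h2

end Source

/-! ## §2 The resolved relative step door -/

section RelativeResolved

variable {ι : Type*} [Fintype ι] [DecidableEq ι]

set_option maxHeartbeats 400000 in -- long hypothesis list + continuity plumbing into `kltc_resolved_dressing_duhamel`; pre-empts the 180k cliff probe
/-- **Relative flow Duhamel, RESOLVED (class-#5 rev-3 step door, second form).**  On `[0,1]`: two Riccati flows with sources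
`Ȧᵢ = −Aᵢ·diag ḃᵢ·Aᵢ + Sᵢ` (entrywise C¹; `ḃᵢ`, `Sᵢ` entrywise continuous), `|Aᵢ| ≤ m`; REMAINING-VARIATION majorants `vᵢ` of the rates
(`vᵢ(·,c)` differentiable, `‖ḃᵢ(t,c)‖ ≤ −v̇ᵢ(t,c)`, `0 ≤ vᵢ(1,c)`, `m·Σ_c vᵢ(0,c) ≤ 1/3`); a relative weight `a(t)` with `ȧ = ḃ₁ − ḃ₂`; the relative residue
`Ẽ(t) = A₁ + A₁·diag a·A₂ − A₂` and relative source `X_rel = S₁·(1 + diag a·A₂) + A₁·diag a·S₂ − S₂` with a resolved slice-integral majorant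
`I(x,y) ≥ ∫₀¹‖X_rel(t)(x,y)‖dt`.  THEN for any `S(x,y) ≥ ‖Ẽ(0)(x,y)‖ + I(x,y)`:
`‖Ẽ(1)(x,y)‖ ≤ S(x,y) + Σ_c S(x,c)v₂(0,c)(3m/2) + Σ_{a′} (3m/2)v₁(0,a′)S(a′,y) + Σ_{a′}Σ_c (3m/2)v₁(0,a′)S(a′,c)v₂(0,c)(3m/2)`. -/
theorem kltc_relative_flow_duhamel_resolved (A₁ A₁' A₂ A₂' S₁ S₂ : ℝ → Matrix ι ι ℂ) (b₁' b₂' a : ℝ → ι → ℂ)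
    (v₁ v₂ v₁' v₂' : ℝ → ι → ℝ) (I S : ι → ι → ℝ) {m : ℝ} (hm : 0 ≤ m)
    (hA₁ : ∀ t ∈ Icc (0 : ℝ) 1, ∀ x y, HasDerivAt (fun s => A₁ s x y) (A₁' t x y) t)
    (hA₂ : ∀ t ∈ Icc (0 : ℝ) 1, ∀ x y, HasDerivAt (fun s => A₂ s x y) (A₂' t x y) t)
    (ha : ∀ t ∈ Icc (0 : ℝ) 1, ∀ c, HasDerivAt (fun s => a s c) (b₁' t c - b₂' t c) t)
    (hS₁c : ∀ x y, ContinuousOn (fun t => S₁ t x y) (Icc 0 1)) (hS₂c : ∀ x y, ContinuousOn (fun t => S₂ t x y) (Icc 0 1))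
    (hflow₁ : ∀ t ∈ Icc (0 : ℝ) 1, A₁' t = -(A₁ t * diagonal (b₁' t) * A₁ t) + S₁ t)
    (hflow₂ : ∀ t ∈ Icc (0 : ℝ) 1, A₂' t = -(A₂ t * diagonal (b₂' t) * A₂ t) + S₂ t)
    (hA₁m : ∀ t ∈ Icc (0 : ℝ) 1, ∀ x y, ‖A₁ t x y‖ ≤ m) (hA₂m : ∀ t ∈ Icc (0 : ℝ) 1, ∀ x y, ‖A₂ t x y‖ ≤ m)
    (hv₁ : ∀ t ∈ Icc (0 : ℝ) 1, ∀ c, HasDerivAt (fun s => v₁ s c) (v₁' t c) t)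
    (hv₂ : ∀ t ∈ Icc (0 : ℝ) 1, ∀ c, HasDerivAt (fun s => v₂ s c) (v₂' t c) t)
    (hr₁ : ∀ t ∈ Icc (0 : ℝ) 1, ∀ c, ‖b₁' t c‖ ≤ -v₁' t c) (hr₂ : ∀ t ∈ Icc (0 : ℝ) 1, ∀ c, ‖b₂' t c‖ ≤ -v₂' t c)
    (hv₁1 : ∀ c, 0 ≤ v₁ 1 c) (hv₂1 : ∀ c, 0 ≤ v₂ 1 c)
    (hZ₁ : m * ∑ c, v₁ 0 c ≤ 1 / 3) (hZ₂ : m * ∑ c, v₂ 0 c ≤ 1 / 3)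
    (hI : ∀ x y, (∫ t in (0 : ℝ)..1, ‖(S₁ t * (1 + diagonal (a t) * A₂ t) + A₁ t * diagonal (a t) * S₂ t - S₂ t) x y‖) ≤ I x y)
    (hS : ∀ x y, ‖(A₁ 0 + A₁ 0 * diagonal (a 0) * A₂ 0 - A₂ 0) x y‖ + I x y ≤ S x y) (x y : ι) :
    ‖(A₁ 1 + A₁ 1 * diagonal (a 1) * A₂ 1 - A₂ 1) x y‖ ≤
      S x y + ∑ c, S x c * v₂ 0 c * (3 / 2 * m) + ∑ a', 3 / 2 * m * v₁ 0 a' * S a' y +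
        ∑ a', ∑ c, 3 / 2 * m * v₁ 0 a' * S a' c * v₂ 0 c * (3 / 2 * m) := by
  -- the relative residue, its derivative and source
  set E : ℝ → Matrix ι ι ℂ := fun t => A₁ t + A₁ t * diagonal (a t) * A₂ t - A₂ t with hE_def
  set a' : ℝ → ι → ℂ := fun t c => b₁' t c - b₂' t c with ha'_def
  set E' : ℝ → Matrix ι ι ℂ := fun t =>
    A₁' t + (A₁' t * diagonal (a t) * A₂ t + A₁ t * diagonal (a' t) * A₂ t + A₁ t * diagonal (a t) * A₂' t) - A₂' t with hE'_def
  set X : ℝ → Matrix ι ι ℂ := fun t => S₁ t * (1 + diagonal (a t) * A₂ t) + A₁ t * diagonal (a t) * S₂ t - S₂ t with hX_def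
  have hdiag : ∀ t, diagonal (a' t) = diagonal (b₁' t) - diagonal (b₂' t) := by
    intro t
    ext u v
    by_cases h : u = v
    · subst h; simp [ha'_def]
    · simp [Matrix.sub_apply, h]
  -- the dressed tangent equation (exact)
  have hflowE : ∀ t ∈ Icc (0 : ℝ) 1, E' t = -(A₁ t * diagonal (b₁' t) * E t + E t * diagonal (b₂' t) * A₂ t) + X t := by
    intro t ht
    simp only [hE'_def, hE_def, hX_def]
    rw [hdiag t]
    exact kltc_relative_flow_identity (A₁ t) (A₁' t) (A₂ t) (A₂' t) (S₁ t) (S₂ t) (diagonal (a t)) (diagonal (b₁' t)) (diagonal (b₂' t))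
      (hflow₁ t ht) (hflow₂ t ht)
  -- entrywise derivative of `E`
  have hEd : ∀ t ∈ Icc (0 : ℝ) 1, ∀ u v, HasDerivAt (fun s => E s u v) (E' t u v) t := fun t ht u v =>
    kltc_relative_hasDerivAt A₁ A₁' A₂ A₂' a a' (hA₁ t ht) (hA₂ t ht) (ha t ht) u v
  -- continuity of the source entries
  have hA₁c : ∀ u v, ContinuousOn (fun t => A₁ t u v) (Icc 0 1) := fun u v t ht => (hA₁ t ht u v).continuousAt.continuousWithinAt
  have hA₂c : ∀ u v, ContinuousOn (fun t => A₂ t u v) (Icc 0 1) := fun u v t ht => (hA₂ t ht u v).continuousAt.continuousWithinAt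
  have hac : ∀ c, ContinuousOn (fun t => a t c) (Icc 0 1) := fun c t ht => (ha t ht c).continuousAt.continuousWithinAt
  have hDa : ∀ u v, ContinuousOn (fun t => diagonal (a t) u v) (Icc 0 1) := kltc_continuousOn_diagonal_apply hac
  have hone : ∀ u v, ContinuousOn (fun _ : ℝ => (1 : Matrix ι ι ℂ) u v) (Icc 0 1) := fun u v => continuousOn_const
  have hXc : ∀ u v, ContinuousOn (fun t => X t u v) (Icc 0 1) := by
    simp only [hX_def]
    exact kltc_continuousOn_sub_apply
      (kltc_continuousOn_add_apply
        (kltc_continuousOn_mul_apply hS₁c (kltc_continuousOn_add_apply hone (kltc_continuousOn_mul_apply hDa hA₂c)))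
        (kltc_continuousOn_mul_apply (kltc_continuousOn_mul_apply hA₁c hDa) hS₂c))
      hS₂c
  -- the start + source majorant
  have hG : ∀ u v, ‖E 0 u v‖ + (∫ t in (0 : ℝ)..1, ‖X t u v‖) ≤ S u v := fun u v => by
    simp only [hE_def, hX_def]
    exact (add_le_add le_rfl (hI u v)).trans (hS u v)
  -- the resolved two-sided dressed Duhamel
  have h := kltc_resolved_dressing_duhamel E E' X A₁ A₂ b₁' b₂' v₁ v₂ v₁' v₂' S hm hEd hXc hflowE hA₁m hA₂m hv₁ hv₂ hr₁ hr₂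
    hv₁1 hv₂1 hZ₁ hZ₂ hG x y
  simpa only [hE_def] using h

end RelativeResolved

end Summit.HubbardSuperconductivity.HubbardSuperconductivity.Theorems.KLRegimeSplit

end
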